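import Summits.Ventures.PercRepro.S1FlatBudget
import Summits.Ventures.PercRepro.S1EightPlanes
import Summits.Ventures.PercRepro.S1JointPerFlatL1

/-!
# PercRepro — S1 THE WEIGHTS OF THE FLAT PROFILE (LEMMAS A + B): `RM`, `RB9`, the per-flat bounds (p2, gen 16;
SUBCLAIM-S1 §4 (A12)–(A13))

With LEMMA B (`S1EightPlanes`: `μ(8) ≥ 48`) an eight-point rank-`4` flat costs `7560·(μ + βK_c(8)) ≤ RM c·#pairs`,
`RM c = 7560 + 158·βK_c(8)`; a nine-point flat `≤ RB9 c·#pairs`, `RB9 c = 7560 + 100·βK_c(9)` (`μ(9) ≥ 76`); a flat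
with `≤ 10` points is charged its pairs at `7560` plus the constant `7560·βK_c(10)`.

* `RM`, `RB9`, `betaK_le_betaK_of_le`, `weight_eight_AB`, `weight_nine_AB`, `weight_huge_AB`;
* `ncard_sUnion_circuitsLE_le_min` — `|S₀| ≤ min(5d, n)`.
Axioms: standard.
-/
open scoped Matroid

namespace PercRepro

namespace S1

open Set

variable {α : Type}

/-- `RM(c) = 7560 + 158·βK_c(8)`: the rate of the eight-point flats under `μ(8) ≥ 48` (`7560/48 = 157.5`). -/
def RM (c : ℕ) : ℕ := 7560 + 158 * betaK 8 c

/-- `RB9(c) = 7560 + 100·βK_c(9)`: the rate of the nine-point flats under `μ(9) ≥ 76` (`7560/76 < 100`). -/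
def RB9 (c : ℕ) : ℕ := 7560 + 100 * betaK 9 c

/-- `βK_c(f)` is monotone in `f`. -/
theorem betaK_le_betaK_of_le {f f' : ℕ} (h : f ≤ f') (c : ℕ) : betaK f c ≤ betaK f' c := by
  unfold betaK
  calc ∑ j ∈ Finset.Icc 6 (min f c), f.choose j ≤ ∑ j ∈ Finset.Icc 6 (min f c), f'.choose j :=
        Finset.sum_le_sum (fun j _ => Nat.choose_le_choose j h)
    _ ≤ ∑ j ∈ Finset.Icc 6 (min f' c), f'.choose j := by
        apply Finset.sum_le_sum_of_subset_of_nonneg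
        · intro j hj
          rw [Finset.mem_Icc] at hj ⊢
          exact ⟨hj.1, hj.2.trans (min_le_min_right c h)⟩
        · intros; exact Nat.zero_le _
    

/-- **The eight-point flats**: `7560·(#rank4Five(F) + βK_c(8)) ≤ RM c · #pairsOf(F)` (Lemma B). -/
theorem weight_eight_AB (M : Matroid α) [M.Finite]
    (hcirc : ∀ C, M.IsCircuit C → 3 ≤ C.encard)
    (hline : ∀ L ⊆ M.E, M.eRk L ≤ 2 → L.ncard ≤ 3) (hplane : ∀ P ⊆ M.E, M.eRk P ≤ 3 → P.ncard ≤ 6)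
    {F : Set α} (hF : F ⊆ M.E) (hcl : M.closure F = F) (hr : M.eRk F = 4) (h8 : F.ncard = 8) (c : ℕ) :
    7560 * ((rank4Five M F).ncard + betaK F.ncard c) ≤ RM c * (pairsOf M F).ncard := by
  have hinj := ncard_rank4Five_le_ncard_pairsOf M hF hcl hr
  have hμ := fortyeight_le_ncard_rank4Five_of_eight M hcirc hline hplane hF hcl hr h8
  rw [h8]
  unfold RM
  nlinarith

/-- **The nine-point flats**: `7560·(#rank4Five(F) + βK_c(9)) ≤ RB9 c · #pairsOf(F)` (`μ(9) ≥ 76`). -/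
theorem weight_nine_AB (M : Matroid α) [M.Finite]
    (hline : ∀ L ⊆ M.E, M.eRk L ≤ 2 → L.ncard ≤ 3) (hplane : ∀ P ⊆ M.E, M.eRk P ≤ 3 → P.ncard ≤ 6)
    {F : Set α} (hF : F ⊆ M.E) (hcl : M.closure F = F) (hr : M.eRk F = 4) (h9 : F.ncard = 9) (c : ℕ) :
    7560 * ((rank4Five M F).ncard + betaK F.ncard c) ≤ RB9 c * (pairsOf M F).ncard := by
  have hinj := ncard_rank4Five_le_ncard_pairsOf M hF hcl hr
  have hμ := five_mul_choose_le_ncard_rank4Five M hline hplane hF hcl hr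
  rw [h9] at hμ ⊢
  have e1 : Nat.choose 9 5 = 126 := by decide
  have e2 : Nat.choose 9 4 = 126 := by decide
  rw [e1, e2] at hμ
  unfold RB9
  nlinarith

/-- **A flat with `≤ 10` points charged at rate one**: `7560·(#rank4Five(F) + βK_c(|F|)) ≤ 7560·#pairsOf(F) +
7560·βK_c(10)`. -/
theorem weight_huge_AB (M : Matroid α) [M.Finite]
    {F : Set α} (hF : F ⊆ M.E) (hcl : M.closure F = F) (hr : M.eRk F = 4) (h10 : F.ncard ≤ 10) (c : ℕ) :
    7560 * ((rank4Five M F).ncard + betaK F.ncard c) ≤ 7560 * (pairsOf M F).ncard + 7560 * betaK 10 c := by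
  have hinj := ncard_rank4Five_le_ncard_pairsOf M hF hcl hr
  have hb := betaK_le_betaK_of_le h10 c
  nlinarith

/-- `|S₀| ≤ min(5d, n)` for the union `S₀` of the circuits with `≤ 5` elements (Corollary N′ and `S₀ ⊆ E`). -/
theorem ncard_sUnion_circuitsLE_le_min (M : Matroid α) [M.Finite] {d : ℕ} (hd : M.E.encard = M.eRank + d) :
    (⋃₀ Matroid.circuitsLE M 5).ncard ≤ min (5 * d) M.E.ncard := by
  have hS₀E : ⋃₀ Matroid.circuitsLE M 5 ⊆ M.E := by
    intro x hx
    obtain ⟨C, hC, hxC⟩ := mem_sUnion.1 hx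
    exact Matroid.subset_ground_of_mem_circuitsLE hC hxC
  have hS₀fin : (⋃₀ Matroid.circuitsLE M 5).Finite := M.ground_finite.subset hS₀E
  refine le_min ?_ (Set.ncard_le_ncard hS₀E M.ground_finite)
  have h := Matroid.encard_sUnion_circuitsLE_le (M := M) (k := 5) (d := d) hd
  rw [← hS₀fin.cast_ncard_eq] at h
  exact_mod_cast h


end S1

end PercRepro
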